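import Mathlib
import Summits.CriticalPhenomena.PercolationContinuityZ3.Theses.PercNearOneGluing

/-!
# Sketch — crux-ideate stmt-CriticalPhenomena-4575 (NoHeavyLowerTail), ideator 3, round 1

First lemmas of the two idea cards, stated as `Prop`s over existing declarations
(`prodBernoulli`, `openConn`, `openConnIn`).  Nothing here is proved; the file must elaborate.

* Card `bhk-sealed-singleton-thinning`: `SealedSingleton` (BHK/Kozma–Nitzan superadditivity,
  the singleton case), `PerScaleLowerTail` (its consequence after Bernoulli thinning of the relay
  set), `LogLossGluing` (Kozma–Nitzan Conjecture 3 up to a `log |A|` loss), `ScaleCoherence`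
  (the residual statement) and the glue `NoHeavyLowerTail_of_scaleCoherence`.
* Card `afree-cluster-pioneers`: `afreeCluster`, `contactProb`, `ManyPioneersOrStrongEntrance`,
  `OneFingerHarmless`, `FewFingersHarmless`.
* Card `meet-closure-four-functions`: `PocketZone`, `SpreadSwitch`.
-/

namespace Summit.CriticalPhenomena.PercolationContinuityZ3.Cruxes.NoHeavyLowerTail.Sketch

open scoped BigOperators Classical
open MeasureTheory Literature.Probability.LatticeModels Literature.Probability.Percolation

/-- Number of relay points of `A` in the open cluster of `o` (the `N` of the crux). -/
noncomputable def relayCount {n : ℕ} (A : Finset (Fin n)) (o : Fin n)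
    (ω : BondConfig (Fin n)) : ℕ :=
  (A.filter fun a => ω ∈ openConn o a).card

/-- **Singleton lemma** (card 1, first lemma; provable now from the van den Berg–Häggström–Kahn
conditional association theorem, via Kozma–Nitzan Lemma 2 with the family of singletons):
on any finite weighted graph, the probability that the open cluster of `o` meets `S` in EXACTLY
one point is at most `max_{a ∈ S} P(a ↮ S \ {a})`. -/
def SealedSingleton : Prop :=
  ∀ (n : ℕ) (w : Sym2 (Fin n) → unitInterval) (S : Finset (Fin n)) (o : Fin n) (η : ℝ),
    0 ≤ η →
    (∀ a ∈ S, (prodBernoulli w).real {ω | ∀ a' ∈ S, a' ≠ a → ω ∉ openConn a a'} ≤ η) →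
    (prodBernoulli w).real {ω | (S.filter fun a => ω ∈ openConn o a).card = 1} ≤ η

/-- **Per-scale lower tail** (card 1, consequence of `SealedSingleton` applied to an independent
`1/k`-Bernoulli sample of `A`): under pairwise `δ`-reliability of `A`, every dyadic scale
`(k/2, k]` with `k ≤ |A|/2` carries lower-tail mass at most `9δ`, uniformly in `|A|`. -/
def PerScaleLowerTail : Prop :=
  ∀ (n : ℕ) (w : Sym2 (Fin n) → unitInterval) (A : Finset (Fin n)) (o : Fin n) (δ : ℝ),
    0 ≤ δ →
    (∀ a ∈ A, ∀ a' ∈ A, 1 - δ < (prodBernoulli w).real (openConn a a')) →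
    ∀ k : ℕ, 1 ≤ k → 2 * k ≤ A.card →
      (prodBernoulli w).real {ω | k < 2 * relayCount A o ω ∧ relayCount A o ω ≤ k} ≤ 9 * δ

/-- **Log-loss near-one gluing** (card 1; Kozma–Nitzan Conjecture 3 with `δ = ε / (C log |A|)`,
obtained by summing `PerScaleLowerTail`-type bounds over the `⌊log₂ |A|⌋ + 1` dyadic scales,
in the form with a target vertex `b`): `P(o ↮ b) ≤ P(o ↮ A) + 6 (⌊log₂|A|⌋+1) · max_a P(a ↮ b)`. -/
def LogLossGluing : Prop :=
  ∀ (n : ℕ) (w : Sym2 (Fin n) → unitInterval) (A : Finset (Fin n)) (o b : Fin n) (δA δb : ℝ),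
    0 ≤ δb →
    (prodBernoulli w).real (⋃ a ∈ A, openConn o a)ᶜ ≤ δA →
    (∀ a ∈ A, (prodBernoulli w).real (openConn a b)ᶜ ≤ δb) →
    (prodBernoulli w).real (openConn o b)ᶜ ≤ δA + 6 * (Nat.log 2 A.card + 1) * δb

/-- **Scale coherence** (card 1, the residual crux of the line): all but `ε/2` of the lower-tail
mass of `N` on `[1, (δ/ε)·EN)` sits on at most `L = L(ε)` dyadic scales. With
`PerScaleLowerTail` this gives the crux (take `δ ≤ ε / (18 L)`). -/
def ScaleCoherence : Prop :=
  ∀ ε : ℝ, 0 < ε → ∃ L : ℕ, ∃ δ : ℝ, 0 < δ ∧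
    ∀ (n : ℕ) (w : Sym2 (Fin n) → unitInterval) (A : Finset (Fin n)) (o : Fin n),
      1 - δ < (prodBernoulli w).real (⋃ a ∈ A, openConn o a) →
      (∀ a ∈ A, ∀ a' ∈ A, 1 - δ < (prodBernoulli w).real (openConn a a')) →
      ∃ K : Finset ℕ, K.card ≤ L ∧
        (prodBernoulli w).real {ω | 1 ≤ relayCount A o ω ∧
            (relayCount A o ω : ℝ) <
              δ * (∑ a ∈ A, (prodBernoulli w).real (openConn o a)) / ε ∧
            ∀ k ∈ K, ¬ (k < 2 * relayCount A o ω ∧ relayCount A o ω ≤ k)} < ε / 2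

/-- Glue of card 1 (logic + a union bound over the `L` exceptional scales). -/
def NoHeavyLowerTail_of_scaleCoherence : Prop :=
  PerScaleLowerTail → ScaleCoherence →
    Summit.CriticalPhenomena.PercolationContinuityZ3.Theses.PercNearOneGluing.NoHeavyLowerTail

/-- The direct contacts ("pioneers") of `o` in `A`: relay points reached from `o` by an open path
whose interior avoids `A`. -/
noncomputable def pioneers {n : ℕ} (A : Finset (Fin n)) (o : Fin n) (ω : BondConfig (Fin n)) :
    Finset (Fin n) :=
  A.filter fun a => ω ∈ openConnIn ((↑A : Set (Fin n))ᶜ ∪ {o, a}) o a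

/-- The `A`-free open cluster `C*` of `o`: vertices outside `A` reached from `o` through vertices
outside `A` (together with `o` itself). -/
def afreeCluster {n : ℕ} (A : Finset (Fin n)) (o : Fin n) (ω : BondConfig (Fin n)) :
    Set (Fin n) :=
  {x | x ∉ A ∧ ω ∈ openConnIn ((↑A : Set (Fin n))ᶜ ∪ {o}) o x} ∪ {o}

/-- Conditional contact probability `c_a(C*)` of the relay point `a` given the `A`-free cluster:
`1 - ∏_{x ∈ C*, x ∼ a} (1 - w(x,a))` (the pioneers are independent Bernoulli(`c_a`) given `C*`). -/
noncomputable def contactProb {n : ℕ} (w : Sym2 (Fin n) → unitInterval) (A : Finset (Fin n))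
    (o a : Fin n) (ω : BondConfig (Fin n)) : ℝ :=
  1 - ∏ x ∈ Finset.univ.filter (fun x => x ∈ afreeCluster A o ω), (1 - (w s(x, a) : ℝ))

/-- **Many pioneers or a strong entrance** (card 2, first lemma; provable now: condition on `C*`,
under which the pioneers are independent Bernoulli(`c_a(C*)`); Chernoff `E e^{-|D|}`; the scalar
inequality `1 - 0.632 c ≤ (1 - c)^{1/2}` on `[0, 1/2]`; Jensen): configurations in which `o` has
at most `d` pioneers AND no relay point is contacted with conditional probability `> 1/2` have
probability at most `e^d √P(o ↮ A)`. (The unconditioned form "`P(|D| ≤ d) ≤ e^d P(o↮A)^{0.63}`"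
is FALSE: `o` joined to a single relay point by a weight-`1` edge.) -/
def ManyPioneersOrStrongEntrance : Prop :=
  ∀ (n : ℕ) (w : Sym2 (Fin n) → unitInterval) (A : Finset (Fin n)) (o : Fin n), o ∉ A →
    ∀ d : ℕ,
      (prodBernoulli w).real {ω | (pioneers A o ω).card ≤ d ∧
          ∀ a ∈ A, contactProb w A o a ω ≤ 1 / 2} ≤
        Real.exp d * Real.sqrt ((prodBernoulli w).real (⋃ a ∈ A, openConn o a)ᶜ)

/-- **Few fingers are harmless, `d = 1`** (card 2 with the spread-switch inequality of card 3;
provable now): a sealed small pocket entered through EXACTLY ONE pioneer costs at most one point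
budget plus `(4/√3) √P(o ↮ A)`, uniformly in `|A|`. -/
def OneFingerHarmless : Prop :=
  ∀ (n : ℕ) (w : Sym2 (Fin n) → unitInterval) (A : Finset (Fin n)) (o : Fin n) (s : ℕ) (η : ℝ),
    o ∉ A →
    (∀ a ∈ A, (prodBernoulli w).real {ω | relayCount A a ω < s} ≤ η) →
    (prodBernoulli w).real {ω | 1 ≤ relayCount A o ω ∧ relayCount A o ω < s ∧
        (pioneers A o ω).card = 1} ≤
      η + 4 / Real.sqrt 3 * Real.sqrt ((prodBernoulli w).real (⋃ a ∈ A, openConn o a)ᶜ)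

/-- **Few fingers are harmless, general `d`** (card 2; proved on paper for `d = 1, 2`, induction on
`d` with popularity thresholds expected): the residual crux is the MANY-finger event. -/
def FewFingersHarmless : Prop :=
  ∀ d : ℕ, ∃ C : ℝ, 0 < C ∧
    ∀ (n : ℕ) (w : Sym2 (Fin n) → unitInterval) (A : Finset (Fin n)) (o : Fin n) (s : ℕ) (η : ℝ),
      o ∉ A → 0 ≤ η →
      (∀ a ∈ A, (prodBernoulli w).real {ω | relayCount A a ω < s} ≤ η) →
      (prodBernoulli w).real {ω | 1 ≤ relayCount A o ω ∧ relayCount A o ω < s ∧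
          (pioneers A o ω).card ≤ d} ≤
        C * (η + (prodBernoulli w).real (⋃ a ∈ A, openConn o a)ᶜ) ^ ((1 : ℝ) / 2 ^ d)

/-- **Pocket-zone lemma** (card 3 `meet-closure-four-functions`, first lemma; provable now from
the Ahlswede–Daykin four functions theorem, Mathlib `four_functions_theorem`): for every
`U ⊆ A`, the events "o's relay block is non-empty and inside `U`" and "… inside `A \ U`" have
product of probabilities at most `P(o ↮ A)` — because the meet (intersection of open edge sets)
of two such configurations disconnects `o` from `A`. -/
def PocketZone : Prop :=
  ∀ (n : ℕ) (w : Sym2 (Fin n) → unitInterval) (A U : Finset (Fin n)) (o : Fin n), U ⊆ A →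
    (prodBernoulli w).real {ω | 1 ≤ relayCount U o ω ∧ relayCount (A \ U) o ω = 0} *
      (prodBernoulli w).real {ω | 1 ≤ relayCount (A \ U) o ω ∧ relayCount U o ω = 0} ≤
    (prodBernoulli w).real (⋃ a ∈ A, openConn o a)ᶜ

/-- **Spread-switch inequality** (card 3; provable now, same meet argument + a greedy split):
for increasing events `E₀, …, E_{L-1}` under a product measure, the probability that EXACTLY ONE
occurs exceeds the largest single "occurs alone" probability by at most `(4/√3) √P(none occurs)`
(sharp up to the constant: the co-point family gives `√2`). -/
def SpreadSwitch : Prop :=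
  ∀ (n L : ℕ) (w : Sym2 (Fin n) → unitInterval) (E : Fin L → Set (BondConfig (Fin n))), 0 < L →
    (∀ i, IsUpperSet (E i)) → (∀ i, MeasurableSet (E i)) →
    ∃ i : Fin L,
      (prodBernoulli w).real {ω | ∃! j, ω ∈ E j} ≤
        (prodBernoulli w).real {ω | ω ∈ E i ∧ ∀ j, j ≠ i → ω ∉ E j} +
          4 / Real.sqrt 3 * Real.sqrt ((prodBernoulli w).real {ω | ∀ j, ω ∉ E j})

/-- Sanity: the crux decl is in scope and is a `Prop`. -/
example : Prop :=
  Summit.CriticalPhenomena.PercolationContinuityZ3.Theses.PercNearOneGluing.NoHeavyLowerTail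

end Summit.CriticalPhenomena.PercolationContinuityZ3.Cruxes.NoHeavyLowerTail.Sketch
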